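import Mathlib
import Summits.MatrixMultiplication.MatrixMultiplication.Theses.AutomaticSTPPDesigns
import Summits.MatrixMultiplication.MatrixMultiplication.Theorems.AutomaticSTPPDesignsRegularTowerGap

/-!
# F3 witness for the rung `ContextFreeTowerGap` (fwd-rung-MatrixMultiplication-04) — standalone copy

Standalone (imports only built tree modules) so the tribunal can re-elaborate it even while the
published ladder module `…Cruxes.AutomaticPackingThesis.FwdRungTowerGapLadder` is not yet in the
farm snapshot; the by-name version of the same witness is
`Summit.MatrixMultiplication.MatrixMultiplication.Cruxes.AutomaticPackingThesis.FwdRung.towerGap_regular`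
in that file.  The graded family `TowerGap 𝒞` below is copied VERBATIM from the ladder file; the
next rung is `ContextFreeTowerGap := TowerGap (fun _ L => L.IsContextFree)`; the floor member
`TowerGap (fun _ L => L.IsRegular)` is definitionally the seed statement `RegularTowerGap` and is
proved by the seed theorem `…Theorems.RegularTowerGap.regularTowerGap_proof`.  No `sorry`.
-/

set_option linter.dupNamespace false

noncomputable section

open scoped BigOperators Classical

namespace Summit.MatrixMultiplication.MatrixMultiplication.Cruxes.AutomaticPackingThesis.FwdRungSpecial

open Summit.MatrixMultiplication.MatrixMultiplication.Theses.AutomaticSTPPDesigns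

/-- Verbatim copy of `FwdRung.TowerGap`. -/
def TowerGap (𝒞 : ∀ α : Type, Language α → Prop) : Prop :=
  ∀ (p : ℕ) (ι : Type) [Fintype ι] (LA LB LC : Language (ι × Fin p)), 2 ≤ p →
    𝒞 _ LA → 𝒞 _ LB → 𝒞 _ LC →
    let blk := fun (k : ℕ) (L : Language (ι × Fin p)) (w : Fin k → ι) =>
      ((Finset.univ : Finset (Fin k → Fin p)).filter
        (fun a => List.ofFn (fun j : Fin k => (w j, a j)) ∈ L)).image
        (fun a : Fin k → Fin p => ((∑ j : Fin k, (a j : ℕ) * p ^ (j : ℕ) : ℕ) : ZMod (p ^ k)));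
    (∀ k : ℕ, Literature.Combinatorics.Additive.AddSimultaneousTPP (blk k LA) (blk k LB) (blk k LC)) →
      ∃ ε : ℝ, 0 < ε ∧ ∃ k₀ : ℕ, ∀ k ≥ k₀,
        ∑ w : Fin k → ι, (((blk k LA w).card * (blk k LB w).card * (blk k LC w).card : ℕ) : ℝ) ^
          ((2 + ε) / 3) ≤ (p : ℝ) ^ k

/-- Verbatim copy of the next rung. -/
def ContextFreeTowerGap : Prop := TowerGap (fun _ L => L.IsContextFree)

/-- **F3.** The rung at the floor parameter `𝒞 = IsRegular` IS the seed theorem (definitional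
specialisation; `simpa [TowerGap]` merely times out normalising the long statement). -/
example : TowerGap (fun _ L => L.IsRegular) := by
  exact Summit.MatrixMultiplication.MatrixMultiplication.Theorems.RegularTowerGap.regularTowerGap_proof

/-- The floor member is the seed statement on the nose. -/
example : TowerGap (fun _ L => L.IsRegular) ↔ RegularTowerGap := Iff.rfl

/-- Antitonicity: the rung gives back the floor once `IsRegular → IsContextFree` is supplied
(monotonicity support absent from Mathlib at present, hence a hypothesis here). -/
example (mono : ∀ (α : Type) (L : Language α), L.IsRegular → L.IsContextFree)
    (h : ContextFreeTowerGap) : TowerGap (fun _ L => L.IsRegular) :=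
  fun p ι _ LA LB LC hp hA hB hC => h p ι LA LB LC hp (mono _ _ hA) (mono _ _ hB) (mono _ _ hC)

end Summit.MatrixMultiplication.MatrixMultiplication.Cruxes.AutomaticPackingThesis.FwdRungSpecial

end
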